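import Literature.AlgebraicGeometry.Resolution.BlowupRegularFlatCover
import Literature.AlgebraicGeometry.Resolution.AffineBlowupUniversal
import Literature.AlgebraicGeometry.Resolution.IdealSheafLemmas
import Literature.AlgebraicGeometry.Resolution.ResolutionGlue
import Literature.AlgebraicGeometry.Resolution.AlterationsProofs
import Mathlib.AlgebraicGeometry.Morphisms.Flat
import Mathlib.AlgebraicGeometry.Noetherian
import HarnessLib

/-!
# Crux `FrobeniusLadder.FRationalResolution` (stmt-ResolutionOfSingularities-15317), line `redirect`,
# stub `stub_diagonalizableQuotientResolution` — regularity of an affine blow-up is fpqc-local and Zariski-local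

Brick T3-core of the repair census (transfer of an `𝔪`-primary regular blow-up along an étale chart
`Spec S₀ → X` at an isolated singular point): the two base-change facts about the affine blowing up
`Bl_I(Spec B)` (`affineBlowup I`, `Literature…AffineBlowup*.lean`) that the transfer consumes, obtained from the
tree's flat base change of blow-ups (`IsBlowup.pullback_snd_of_flat`, GW Prop. 13.91 (2)), the uniqueness of
blow-ups (`IsBlowup.unique`) and flat descent of regularity (`IsBlowup.isRegular_of_flat_cover`, Matsumura 23.7):

* (`Scheme.IsRegular.of_isOpenImmersion` is reused from `AlterationsProofs.lean`.)
* `idealSheaf_comap_specMap` — the inverse image of the ideal sheaf `Ĩ` of `Spec B` along `Spec C → Spec B` is the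
  ideal sheaf of `I C`;
* `isRegular_affineBlowup_map_of_isOpenImmersion` — **Zariski-local**: if `Spec C → Spec B` is an open immersion
  (e.g. `C = B_h`) and `Bl_I(Spec B)` is regular, so is `Bl_{IC}(Spec C)` (it is an open piece);
* `isRegular_affineBlowup_of_flat_of_surjective` — **fpqc descent**: if `B → C` is flat with `Spec C → Spec B`
  surjective (`B` Noetherian) and `Bl_{IC}(Spec C)` is regular, then `Bl_I(Spec B)` is regular.

In the transfer: `B = Γ(U)` an affine neighbourhood of the singular point, `C` the (localized) chart ring, `I` the
descended `𝔪_x`-primary centre (`…PrimaryDescent.lean`) with `IC = J` the chart's centre. Honest label: plumbing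
(no stub closed). No definitions, no named facts, no sorry. [folklore; cite: GortzWedhorn2020, Prop. 13.91 (2);
Matsumura1987, Thm. 23.7]
-/

noncomputable section

-- single-problem summit: the doubled namespace component is forced
set_option linter.dupNamespace false

open CategoryTheory CategoryTheory.Limits AlgebraicGeometry TopologicalSpace
open Literature.AlgebraicGeometry.Resolution

namespace Summit.ResolutionOfSingularities.ResolutionOfSingularities.Theorems.FRationalResolution.BlowupFlatCriteria

universe u

variable {B C : Type u} [CommRing B] [CommRing C] (φ : B →+* C) (I : Ideal B)

/-- **Inverse image of `Ĩ` along `Spec C → Spec B` is `(IC)~`.** [folklore] -/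
theorem idealSheaf_comap_specMap :
    (affineBlowup.idealSheaf I).comap (Spec.map (CommRingCat.ofHom φ)) =
      affineBlowup.idealSheaf (I.map φ) := by
  rw [affineBlowup.idealSheaf, affineBlowup.idealSheaf, comap_ofIdealTop_of_isAffine, Ideal.map_map,
    Ideal.map_map]
  have h := congrArg (fun f => CommRingCat.Hom.hom f)
    (Scheme.ΓSpecIso_inv_naturality (CommRingCat.ofHom φ))
  simp only [CommRingCat.hom_comp, CommRingCat.hom_ofHom] at h
  rw [h]

/-- **Regularity of `Bl_I` is Zariski-local on the base**: if `Spec C → Spec B` is an open immersion (e.g. the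
localization `B → B_h`) and `Bl_I(Spec B)` is regular, then `Bl_{IC}(Spec C)` is regular — it is the open piece
`Bl_I(Spec B) ×_{Spec B} Spec C` (flat base change of blow-ups + uniqueness). [cite: GortzWedhorn2020, Prop. 13.91 (2)] -/
theorem isRegular_affineBlowup_map_of_isOpenImmersion
    [IsOpenImmersion (Spec.map (CommRingCat.ofHom φ))]
    (hreg : Scheme.IsRegular (affineBlowup I)) : Scheme.IsRegular (affineBlowup (I.map φ)) := by
  set j := Spec.map (CommRingCat.ofHom φ) with hj
  -- the base change of `Bl_I(Spec B)` along the open immersion is a blow-up of `Spec C` along `(IC)~`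
  have hbc : IsBlowup (pullback.snd (affineBlowup.π I) j) (affineBlowup.idealSheaf (I.map φ)) := by
    rw [← idealSheaf_comap_specMap]
    exact (affineBlowup.isBlowup I).pullback_snd_of_flat j
  -- it is an open piece of `Bl_I(Spec B)`, hence regular
  have hPreg : Scheme.IsRegular (pullback (affineBlowup.π I) j) :=
    Scheme.IsRegular.of_isOpenImmersion (pullback.fst (affineBlowup.π I) j) hreg
  -- uniqueness of blow-ups
  obtain ⟨e, -, -⟩ := hbc.unique (affineBlowup.isBlowup (I.map φ))
  exact Scheme.IsRegular.of_iso e.hom hPreg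

/-- **Regularity of `Bl_I` descends along a flat ring map with surjective spectrum map** (fpqc descent): for `B`
Noetherian, `φ : B → C` flat with `Spec C → Spec B` surjective, if `Bl_{IC}(Spec C)` is regular then `Bl_I(Spec B)`
is regular (`Bl_I ×_{Spec B} Spec C` is a blow-up along `(IC)~`, unique up to isomorphism, and regularity descends
along the flat local homomorphisms of the projection). [cite: GortzWedhorn2020, Prop. 13.91 (2)]
[cite: Matsumura1987, Thm. 23.7] -/
theorem isRegular_affineBlowup_of_flat_of_surjective [IsNoetherianRing B] (hφ : φ.Flat)
    (hsurj : Function.Surjective (PrimeSpectrum.comap φ))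
    (hreg : Scheme.IsRegular (affineBlowup (I.map φ))) : Scheme.IsRegular (affineBlowup I) := by
  haveI : Flat (Spec.map (CommRingCat.ofHom φ)) := by
    rw [HasRingHomProperty.Spec_iff (P := @Flat), CommRingCat.hom_ofHom]
    exact hφ
  haveI : IsLocallyNoetherian (affineBlowup I) :=
    LocallyOfFiniteType.isLocallyNoetherian (affineBlowup.π I)
  refine (affineBlowup.isBlowup I).isRegular_of_flat_cover
    (e := fun _ : Unit => Spec.map (CommRingCat.ofHom φ)) ?_ ?_
  · intro x
    obtain ⟨y, hy⟩ := hsurj x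
    exact ⟨(), y, hy⟩
  · intro _ P q hq
    rw [idealSheaf_comap_specMap] at hq
    obtain ⟨e, -, -⟩ := (affineBlowup.isBlowup (I.map φ)).unique hq
    exact Scheme.IsRegular.of_iso e.hom hreg

end Summit.ResolutionOfSingularities.ResolutionOfSingularities.Theorems.FRationalResolution.BlowupFlatCriteria

end
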